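import Literature.Analysis.FluidPDE.ControlledHardSphereDynamics
import Literature.Analysis.FluidPDE.HardSphereRegularGeometry
import Literature.Analysis.FluidPDE.HardSphereUniqueness
import Literature.Analysis.FluidPDE.HardSphereAlexander
import HarnessLib

/-!
# The `η`-freedom control system of hard spheres: the true policy on the torus, non-vacuity

Companion to `Literature.Analysis.FluidPDE.ControlledHardSphereDynamics` (the `η`-freedom control
system `IsControlledHardSphereTrajectory` / `ControlPolicy` / `ControlPolicy.Reach` /
`SteerableWithFreedom`, definition item `defn-ControlledHardSphereTrajectory`), written for the
re-attached request `defn-ControlledHardSphereTrajectory-2` of the crux `LaneReachability` of route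
SinaiSteeringDichotomy (AtomisticToContinuum/HydrodynamicLimit), whose setting is the flat torus
`𝕋³ = UnitAddTorus (Fin 3)` with the minimal-image geometry `Torus.geometry`.

Two things the base file leaves open in that setting are supplied here, theorem-only:

* **The true policy on hard-sphere regular geometries (torus).** The sanity theorems of the base
  file saying that the *true policy* (only the contact normal allowed) gives back the uncontrolled
  dynamics — `IsHardSphereTrajectory.trueNormal_eq_or`, `IsHardSphereTrajectory.admissible_truePolicy`,
  `isHardSphereTrajectory_iff_exists_admissible_truePolicy` — assume the GLOBAL antisymmetry
  `∀ x y, G.sepVec y x = -G.sepVec x y` of the separation map. This holds for `Euclidean.geometry`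
  but FAILS for `Torus.geometry` (the symmetric representative `Torus.reprSym` takes values in
  `(-1/2, 1/2]^d`, so antisymmetry breaks at half-way pairs). Only antisymmetry ON PAIRS AT
  DISTANCE `≤ ε` is ever used (the normal is read off at contact, `‖sepVec‖ = ε`), and that is the
  field `sepVec_comm` of `Geometry.IsHardSphereRegular G ε` (`HardSphereRegularGeometry`), valid on
  the torus for `ε < 1/2` (`Torus.isHardSphereRegular_geometry`). The three theorems are re-proved
  under the local hypothesis (`…_of_sepVec_comm`) and specialised to regular geometries, to the
  torus and to `ℝ^d`.
* **Reachable sets of the true policy; non-vacuity.** Along a hard-sphere trajectory `γ` the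
  reachable set of the true policy from `γ 0` at a time `t ≥ 0` is EXACTLY `{γ t}`
  (`IsHardSphereTrajectory.reach_truePolicy_eq`; `⊇` by admissibility of `γ` with its true
  normals, `⊆` by forward uniqueness of hard-sphere trajectories,
  `IsHardSphereTrajectory.unique_holds`), so the true policy steers `γ 0` into `B` at time `t` iff
  `γ t ∈ B` (`steers_truePolicy_iff`), and since the true policy is strictly causal, well posed and
  has every freedom `η ≤ 0`, `SteerableWithFreedom G ε N η t (γ 0) B` holds for `η ≤ 0` as soon as
  `γ t ∈ B` (`steerableWithFreedom_of_nonpos`: the content of `η`-freedom steering is entirely in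
  `η > 0`). For a hard-sphere flow `Φ` (`HardSphereFlow`) the same holds from every good initial
  datum (`HardSphereFlow.reach_truePolicy_eq`, `HardSphereFlow.flow_mem_reach`), and by Alexander's
  theorem on the torus (`HardSphereFlow.nonempty_torus_holds`, `0 < ε < 1/2`) the reachable sets of
  every policy allowing the true normals are nonempty from Liouville-almost every initial datum, at
  every time (`Torus.ae_reach_nonempty`) — the non-vacuity of the control system consumed by
  `ControlPolicy.Steers` (which asks `(P.Reach …).Nonempty`).
* Bookkeeping at time `0`: `ControlPolicy.reach_zero_subset` (`Reach P G ε 0 z₀ ⊆ {z₀}`),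
  `ControlPolicy.steers_zero_iff`, `ControlPolicy.Admissible.mem_reach`.

No new definitions and no named facts are introduced.

## References

* I. Gallagher, L. Saint-Raymond, B. Texier, *From Newton to Boltzmann* (2013), §4.1,
  Prop. 4.1.1 (hard-sphere trajectories, forward uniqueness, Alexander's flow on `𝕋^d`).
* R. K. Alexander, *The infinite hard sphere system*, PhD thesis, Berkeley (1975).
* E. Ott, C. Grebogi, J. A. Yorke, *Controlling chaos*, Phys. Rev. Lett. 64 (1990) 1196 (control
  by small admissible interventions at naturally occurring events — the setting of the base file).
-/

open MeasureTheory Set Filter Topology Metric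
open scoped ENNReal InnerProductSpace

namespace Literature.Analysis.FluidPDE

noncomputable section

section Kinetic

variable {d : Type*} [Fintype d] {X : Type*} {N : ℕ}

section Trajectory

variable [TopologicalSpace X]

/-! ## Time zero; admissible trajectories populate the reachable sets -/

namespace ControlPolicy

/-- At time `0` the reachable set from `z₀` is contained in `{z₀}` (it equals `{z₀}` iff some
admissible trajectory starts at `z₀`). [folklore] -/
theorem reach_zero_subset (P : ControlPolicy d X N) (G : Geometry d X) (ε : ℝ) (z₀ : Config N d X) :
    P.Reach G ε 0 z₀ ⊆ {z₀} := by
  rintro z ⟨γ, ν, -, h0, ht⟩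
  exact mem_singleton_iff.2 (ht.symm.trans h0)

/-- Steering at time `0`: some admissible trajectory starts at `z₀`, and `z₀ ∈ B`. [folklore] -/
theorem steers_zero_iff (P : ControlPolicy d X N) (G : Geometry d X) (ε : ℝ) (z₀ : Config N d X)
    (B : Set (Config N d X)) :
    P.Steers G ε 0 z₀ B ↔ (P.Reach G ε 0 z₀).Nonempty ∧ z₀ ∈ B := by
  refine ⟨fun ⟨hne, hsub⟩ => ⟨hne, ?_⟩, fun ⟨hne, hB⟩ => ⟨hne, fun z hz => ?_⟩⟩
  · obtain ⟨z, hz⟩ := hne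
    have hz₀ : z = z₀ := mem_singleton_iff.1 (reach_zero_subset P G ε z₀ hz)
    exact hz₀ ▸ hsub hz
  · rw [mem_singleton_iff.1 (reach_zero_subset P G ε z₀ hz)]
    exact hB

/-- An admissible trajectory realises, at every time, a point of the reachable set from its
initial value. [folklore] -/
theorem Admissible.mem_reach {P : ControlPolicy d X N} {G : Geometry d X} {ε : ℝ}
    {γ : ℝ → Config N d X} {ν : ℝ → EuclideanSpace ℝ d} (h : P.Admissible G ε γ ν) (t : ℝ) :
    γ t ∈ P.Reach G ε t (γ 0) :=
  ⟨γ, ν, h, rfl, rfl⟩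

/-- An admissible trajectory from `z₀` makes every reachable set from `z₀` nonempty. [folklore] -/
theorem Admissible.reach_nonempty {P : ControlPolicy d X N} {G : Geometry d X} {ε : ℝ}
    {γ : ℝ → Config N d X} {ν : ℝ → EuclideanSpace ℝ d} (h : P.Admissible G ε γ ν) (t : ℝ) :
    (P.Reach G ε t (γ 0)).Nonempty :=
  ⟨γ t, h.mem_reach t⟩

end ControlPolicy

/-! ## The true policy under LOCAL antisymmetry of the separation map (regular geometries, torus) -/

/-- Along a hard-sphere trajectory, at a contact time of `(i, j)` the realised normal is
`±ε⁻¹ (x_i - x_j)` — assuming antisymmetry of the separation map only on pairs at distance `≤ ε`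
(the field `sepVec_comm` of `Geometry.IsHardSphereRegular`; true on the torus for `ε < 1/2`,
where global antisymmetry fails). [folklore] -/
theorem IsHardSphereTrajectory.trueNormal_eq_or_of_sepVec_comm {G : Geometry d X} {ε : ℝ}
    (hG : ∀ x y : X, ‖G.sepVec x y‖ ≤ ε → G.sepVec y x = -G.sepVec x y)
    {γ : ℝ → Config N d X} (h : IsHardSphereTrajectory G ε N γ) {t : ℝ} {i j : Fin N} (hij : i ≠ j)
    (ht : γ t ∈ contactSet G N ε i j) :
    trueNormal G ε γ t = ε⁻¹ • G.sepVec ((γ t) i).1 ((γ t) j).1 ∨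
      trueNormal G ε γ t = -(ε⁻¹ • G.sepVec ((γ t) i).1 ((γ t) j).1) := by
  classical
  have h' : ∃ p : Fin N × Fin N, p.1 ≠ p.2 ∧ γ t ∈ contactSet G N ε p.1 p.2 := ⟨(i, j), hij, ht⟩
  obtain ⟨hne, hmem⟩ := Classical.choose_spec h'
  have hpair := (h.binary t i j hij ht).1 _ _ hne hmem
  have h1 : (Classical.choose h').1 ∈ ({i, j} : Finset (Fin N)) := by rw [← hpair]; simp
  have h2 : (Classical.choose h').2 ∈ ({i, j} : Finset (Fin N)) := by rw [← hpair]; simp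
  simp only [Finset.mem_insert, Finset.mem_singleton] at h1 h2
  simp only [trueNormal, dif_pos h']
  rcases h1 with h1 | h1 <;> rcases h2 with h2 | h2
  · exact absurd (h1.trans h2.symm) hne
  · left; rw [h1, h2]
  · right; rw [h1, h2, hG _ _ ht.2.le, smul_neg]
  · exact absurd (h1.trans h2.symm) hne

/-- **Hard-sphere trajectory ⇒ admissible for the true policy** with the realised normals
`trueNormal`, under LOCAL antisymmetry of the separation map (pairs at distance `≤ ε`), `0 < ε`
and a Hausdorff position space — the torus-applicable form of
`IsHardSphereTrajectory.admissible_truePolicy`. [folklore] -/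
theorem IsHardSphereTrajectory.admissible_truePolicy_of_sepVec_comm [T2Space X] {G : Geometry d X}
    {ε : ℝ} (hG : ∀ x y : X, ‖G.sepVec x y‖ ≤ ε → G.sepVec y x = -G.sepVec x y) (hε : 0 < ε)
    {γ : ℝ → Config N d X} (h : IsHardSphereTrajectory G ε N γ) :
    (truePolicy G ε).Admissible G ε γ (trueNormal G ε γ) := by
  have hpos : ∀ t (i : Fin N) (zl : Config N d X), Tendsto γ (𝓝[<] t) (𝓝 zl) →
      (zl i).1 = (γ t i).1 := by
    intro t i zl hzl
    have hc : Continuous fun z : Config N d X => (z i).1 := continuous_fst.comp (continuous_apply i)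
    have h1 : Tendsto (fun s => (γ s i).1) (𝓝[<] t) (𝓝 (zl i).1) := (hc.tendsto zl).comp hzl
    exact tendsto_nhds_unique h1 (((h.pos_continuous i).tendsto t).mono_left nhdsWithin_le_nhds)
  refine ⟨⟨h.mem, h.locFinite, h.pos_continuous, h.free, fun t i j hij ht => ?_⟩,
    fun t i j hij ht => by
      rw [truePolicy_allowed_eq G ε h.pos_continuous]
      exact h.trueNormal_eq_or_of_sepVec_comm hG hij ht⟩
  obtain ⟨huniq, zl, hzl, hin, hjump⟩ := h.binary t i j hij ht
  have hn := h.trueNormal_eq_or_of_sepVec_comm hG hij ht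
  refine ⟨huniq, zl, hzl, hin, ?_, ?_, hjump ▸ (isOutgoing_collidePair_iff hij zl).2 hin⟩
  · have hnorm : ‖ε⁻¹ • G.sepVec ((γ t) i).1 ((γ t) j).1‖ = 1 := by
      rw [norm_smul, norm_inv, Real.norm_eq_abs, abs_of_pos hε, ht.2, inv_mul_cancel₀ hε.ne']
    rcases hn with hn | hn
    · rw [hn, hnorm]
    · rw [hn, norm_neg, hnorm]
  · rw [← hpos t i zl hzl, ← hpos t j zl hzl] at hn
    rw [collidePairWith_eq_collidePair_of_mem_truePolicy hε.ne' hn, hjump]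

/-- **The true policy gives back the hard-sphere dynamics** under LOCAL antisymmetry: `γ` is a
hard-sphere trajectory iff it is admissible for the true policy with some realised normals. [folklore] -/
theorem isHardSphereTrajectory_iff_exists_admissible_truePolicy_of_sepVec_comm [T2Space X]
    {G : Geometry d X} {ε : ℝ} (hG : ∀ x y : X, ‖G.sepVec x y‖ ≤ ε → G.sepVec y x = -G.sepVec x y)
    (hε : 0 < ε) {γ : ℝ → Config N d X} :
    IsHardSphereTrajectory G ε N γ ↔ ∃ ν, (truePolicy G ε).Admissible G ε γ ν :=
  ⟨fun h => ⟨_, h.admissible_truePolicy_of_sepVec_comm hG hε⟩,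
    fun ⟨_, h⟩ => h.isHardSphereTrajectory hε.ne'⟩

/-- On a hard-sphere regular geometry (`Geometry.IsHardSphereRegular G ε`: `ℝ^d`, or `𝕋^d` with
`ε < 1/2`) the true policy gives back the hard-sphere dynamics. [folklore] -/
theorem Geometry.IsHardSphereRegular.isHardSphereTrajectory_iff_exists_admissible_truePolicy
    [T2Space X] {G : Geometry d X} {ε : ℝ} (hG : G.IsHardSphereRegular ε) (hε : 0 < ε)
    {γ : ℝ → Config N d X} :
    IsHardSphereTrajectory G ε N γ ↔ ∃ ν, (truePolicy G ε).Admissible G ε γ ν :=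
  isHardSphereTrajectory_iff_exists_admissible_truePolicy_of_sepVec_comm hG.sepVec_comm hε

/-- **On the flat torus `𝕋^d`** (`0 < ε < 1/2`): a curve is a hard-sphere trajectory iff it is
admissible for the true policy — the sanity statement of the `η`-freedom control system in the
setting of `LaneReachability`. [folklore] -/
theorem Torus.isHardSphereTrajectory_iff_exists_admissible_truePolicy {ε : ℝ} (hε : 0 < ε)
    (hε' : ε < 2⁻¹) {γ : ℝ → Config N d (UnitAddTorus d)} :
    IsHardSphereTrajectory (Torus.geometry d) ε N γ ↔
      ∃ ν, (truePolicy (Torus.geometry d) ε).Admissible (Torus.geometry d) ε γ ν :=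
  (Torus.isHardSphereRegular_geometry hε').isHardSphereTrajectory_iff_exists_admissible_truePolicy hε

/-- **On `ℝ^d`** (`0 < ε`): a curve is a hard-sphere trajectory iff it is admissible for the true
policy. [folklore] -/
theorem Euclidean.isHardSphereTrajectory_iff_exists_admissible_truePolicy {ε : ℝ} (hε : 0 < ε)
    {γ : ℝ → Config N d (EuclideanSpace ℝ d)} :
    IsHardSphereTrajectory (Euclidean.geometry d) ε N γ ↔
      ∃ ν, (truePolicy (Euclidean.geometry d) ε).Admissible (Euclidean.geometry d) ε γ ν :=
  (Euclidean.isHardSphereRegular_geometry ε).isHardSphereTrajectory_iff_exists_admissible_truePolicy hε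

/-! ## Reachable sets of the true policy: exactly the uncontrolled orbit -/

/-- Every hard-sphere trajectory realises, at every time `t`, a point of the reachable set of the
true policy from `γ 0` (local antisymmetry, `0 < ε`, Hausdorff positions). [folklore] -/
theorem IsHardSphereTrajectory.mem_reach_truePolicy [T2Space X] {G : Geometry d X} {ε : ℝ}
    (hG : ∀ x y : X, ‖G.sepVec x y‖ ≤ ε → G.sepVec y x = -G.sepVec x y) (hε : 0 < ε)
    {γ : ℝ → Config N d X} (h : IsHardSphereTrajectory G ε N γ) (t : ℝ) :
    γ t ∈ (truePolicy G ε).Reach G ε t (γ 0) :=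
  (h.admissible_truePolicy_of_sepVec_comm hG hε).mem_reach t

/-- A policy allowing the true normals reaches (at least) the uncontrolled orbit. [folklore] -/
theorem IsHardSphereTrajectory.mem_reach_of_truePolicy_le [T2Space X] {G : Geometry d X} {ε : ℝ}
    (hG : ∀ x y : X, ‖G.sepVec x y‖ ≤ ε → G.sepVec y x = -G.sepVec x y) (hε : 0 < ε)
    {P : ControlPolicy d X N}
    (hP : ∀ γ t i j, (truePolicy G ε).allowed γ t i j ⊆ P.allowed γ t i j)
    {γ : ℝ → Config N d X} (h : IsHardSphereTrajectory G ε N γ) (t : ℝ) :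
    γ t ∈ P.Reach G ε t (γ 0) :=
  ControlPolicy.reach_mono hP G ε t (γ 0) (h.mem_reach_truePolicy hG hε t)

/-- **The true policy gives back the uncontrolled dynamics, at the level of reachable sets**:
along a hard-sphere trajectory `γ`, for `t ≥ 0` the reachable set of the true policy from `γ 0`
is exactly `{γ t}` (`⊇`: `γ` is admissible with its true normals; `⊆`: a trajectory admissible
for the true policy is a hard-sphere trajectory, `Admissible.isHardSphereTrajectory`, and
hard-sphere trajectories are forward unique, `IsHardSphereTrajectory.unique_holds`). [folklore] -/
theorem IsHardSphereTrajectory.reach_truePolicy_eq [T2Space X] {G : Geometry d X} {ε : ℝ}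
    (hG : ∀ x y : X, ‖G.sepVec x y‖ ≤ ε → G.sepVec y x = -G.sepVec x y) (hε : 0 < ε)
    {γ : ℝ → Config N d X} (h : IsHardSphereTrajectory G ε N γ) {t : ℝ} (ht : 0 ≤ t) :
    (truePolicy G ε).Reach G ε t (γ 0) = {γ t} := by
  refine Subset.antisymm ?_ (singleton_subset_iff.2 (h.mem_reach_truePolicy hG hε t))
  rintro z ⟨γ', ν, hadm, h0, rfl⟩
  have h' : IsHardSphereTrajectory G ε N γ' := hadm.isHardSphereTrajectory hε.ne'
  have hEq : EqOn γ γ' (Ici 0) := IsHardSphereTrajectory.unique_holds h h' h0.symm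
  exact mem_singleton_iff.2 (hEq (mem_Ici.2 ht)).symm

/-- The true policy steers `γ 0` into `B` at time `t ≥ 0` iff the uncontrolled orbit is in `B`
at time `t`. [folklore] -/
theorem IsHardSphereTrajectory.steers_truePolicy_iff [T2Space X] {G : Geometry d X} {ε : ℝ}
    (hG : ∀ x y : X, ‖G.sepVec x y‖ ≤ ε → G.sepVec y x = -G.sepVec x y) (hε : 0 < ε)
    {γ : ℝ → Config N d X} (h : IsHardSphereTrajectory G ε N γ) {t : ℝ} (ht : 0 ≤ t)
    {B : Set (Config N d X)} :
    (truePolicy G ε).Steers G ε t (γ 0) B ↔ γ t ∈ B := by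
  rw [ControlPolicy.Steers, h.reach_truePolicy_eq hG hε ht]
  simp

/-- A two-point set `{c, -c}` of `ℝ^d`, traced on the unit sphere, is measurable. [folklore] -/
theorem measurableSet_preimage_sphere_pair (c : EuclideanSpace ℝ d) :
    MeasurableSet ((↑) ⁻¹' {n : EuclideanSpace ℝ d | n = c ∨ n = -c} :
      Set (sphere (0 : EuclideanSpace ℝ d) 1)) := by
  have hc : ({n : EuclideanSpace ℝ d | n = c ∨ n = -c} : Set (EuclideanSpace ℝ d)) = {c, -c} := by
    ext n
    simp
  rw [hc]
  exact measurable_subtype_coe (((Set.finite_singleton (-c)).insert c).measurableSet)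

/-- **The true policy has every freedom `η ≤ 0`** (its assigned sets are two-point sets on the
sphere, measurable; the measure lower bound is void for `η ≤ 0`). [folklore] -/
theorem truePolicy_hasFreedom_of_nonpos (G : Geometry d X) (ε : ℝ) {η : ℝ} (hη : η ≤ 0) :
    (truePolicy G ε : ControlPolicy d X N).HasFreedom η := by
  intro γ t i j
  refine ⟨?_, ?_⟩
  · simp only [truePolicy]
    exact measurableSet_preimage_sphere_pair _
  · rw [ENNReal.ofReal_of_nonpos hη, zero_mul]
    exact bot_le

/-- **Freedom-`0` steerability is membership along the uncontrolled orbit**: for `η ≤ 0`, `t ≥ 0`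
and a hard-sphere trajectory `γ` with `γ t ∈ B`, `γ 0` is steerable into `B` at time `t` with
freedom `η` — witnessed by the true policy (strictly causal, well posed, of freedom `η ≤ 0`, and
steering exactly along `γ`). The content of `SteerableWithFreedom` is thus entirely in `η > 0`. [folklore] -/
theorem IsHardSphereTrajectory.steerableWithFreedom_of_nonpos [T2Space X] {G : Geometry d X} {ε : ℝ}
    (hG : ∀ x y : X, ‖G.sepVec x y‖ ≤ ε → G.sepVec y x = -G.sepVec x y) (hε : 0 < ε)
    {γ : ℝ → Config N d X} (h : IsHardSphereTrajectory G ε N γ) {η : ℝ} (hη : η ≤ 0) {t : ℝ}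
    (ht : 0 ≤ t) {B : Set (Config N d X)} (hB : γ t ∈ B) :
    SteerableWithFreedom G ε N η t (γ 0) B :=
  ⟨truePolicy G ε, truePolicy_isCausal G ε, truePolicy_wellPosed G hε.ne',
    truePolicy_hasFreedom_of_nonpos G ε hη, (h.steers_truePolicy_iff hG hε ht).2 hB⟩

end Trajectory

/-! ## Hard-sphere flows; the torus -/

section Flow

variable [MeasureSpace X] [TopologicalSpace X]

/-- Along a hard-sphere flow, from a good initial datum the time-`t` value is reachable for the
true policy (every `t`). [folklore] -/
theorem HardSphereFlow.flow_mem_reach_truePolicy [T2Space X] {G : Geometry d X} {ε : ℝ}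
    (hG : ∀ x y : X, ‖G.sepVec x y‖ ≤ ε → G.sepVec y x = -G.sepVec x y) (hε : 0 < ε)
    (Φ : HardSphereFlow G ε N) {z : Config N d X} (hz : z ∈ Φ.good) (t : ℝ) :
    Φ.flow t z ∈ (truePolicy G ε).Reach G ε t z := by
  have h := (Φ.isTrajectory z hz).mem_reach_truePolicy hG hε t
  simp only [Φ.flow_zero z hz] at h
  exact h

/-- Along a hard-sphere flow, from a good initial datum the time-`t` value is reachable for every
policy allowing the true normals. [folklore] -/
theorem HardSphereFlow.flow_mem_reach [T2Space X] {G : Geometry d X} {ε : ℝ}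
    (hG : ∀ x y : X, ‖G.sepVec x y‖ ≤ ε → G.sepVec y x = -G.sepVec x y) (hε : 0 < ε)
    (Φ : HardSphereFlow G ε N) {P : ControlPolicy d X N}
    (hP : ∀ γ t i j, (truePolicy G ε).allowed γ t i j ⊆ P.allowed γ t i j)
    {z : Config N d X} (hz : z ∈ Φ.good) (t : ℝ) : Φ.flow t z ∈ P.Reach G ε t z :=
  ControlPolicy.reach_mono hP G ε t z (Φ.flow_mem_reach_truePolicy hG hε hz t)

/-- **Reachable sets of the true policy along a hard-sphere flow**: from a good initial datum `z`
and for `t ≥ 0`, `Reach (truePolicy) t z = {Φ_t z}`. [folklore] -/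
theorem HardSphereFlow.reach_truePolicy_eq [T2Space X] {G : Geometry d X} {ε : ℝ}
    (hG : ∀ x y : X, ‖G.sepVec x y‖ ≤ ε → G.sepVec y x = -G.sepVec x y) (hε : 0 < ε)
    (Φ : HardSphereFlow G ε N) {z : Config N d X} (hz : z ∈ Φ.good) {t : ℝ} (ht : 0 ≤ t) :
    (truePolicy G ε).Reach G ε t z = {Φ.flow t z} := by
  have h := (Φ.isTrajectory z hz).reach_truePolicy_eq hG hε ht
  simp only [Φ.flow_zero z hz] at h
  exact h

/-- **Non-vacuity of the control system on the torus** (Alexander's theorem,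
`HardSphereFlow.nonempty_torus_holds`): for `0 < ε < 1/2` and every `N` there is a hard-sphere flow
`Φ` on `(𝕋^d × ℝ^d)^N`, and from every good initial datum the reachable set of the true policy at
time `t ≥ 0` is `{Φ_t z}`. [folklore] -/
theorem Torus.exists_hardSphereFlow_reach_truePolicy_eq {ε : ℝ} (hε : 0 < ε) (hε' : ε < 2⁻¹)
    (N : ℕ) :
    ∃ Φ : HardSphereFlow (Torus.geometry d) ε N, ∀ z ∈ Φ.good, ∀ t : ℝ, 0 ≤ t →
      (truePolicy (Torus.geometry d) ε).Reach (Torus.geometry d) ε t z = {Φ.flow t z} := by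
  obtain ⟨Φ⟩ := HardSphereFlow.nonempty_torus_holds (d := d) hε hε' N
  exact ⟨Φ, fun z hz t ht =>
    Φ.reach_truePolicy_eq (Torus.isHardSphereRegular_geometry hε').sepVec_comm hε hz ht⟩

/-- **Non-vacuity on the torus, almost everywhere**: for `0 < ε < 1/2`, every `N` and every policy
`P` allowing the true normals, from Liouville-almost every initial datum every reachable set
`P.Reach (Torus.geometry d) ε t z` is nonempty (all times `t`). [folklore] -/
theorem Torus.ae_reach_nonempty {ε : ℝ} (hε : 0 < ε) (hε' : ε < 2⁻¹) (N : ℕ)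
    {P : ControlPolicy d (UnitAddTorus d) N}
    (hP : ∀ γ t i j, (truePolicy (Torus.geometry d) ε).allowed γ t i j ⊆ P.allowed γ t i j) :
    ∀ᵐ z ∂liouville (Torus.geometry d) N ε, ∀ t : ℝ, (P.Reach (Torus.geometry d) ε t z).Nonempty := by
  obtain ⟨Φ⟩ := HardSphereFlow.nonempty_torus_holds (d := d) hε hε' N
  filter_upwards [Φ.ae_mem_good] with z hz t
  exact ⟨Φ.flow t z,
    Φ.flow_mem_reach (Torus.isHardSphereRegular_geometry hε').sepVec_comm hε hP hz t⟩

/-- In particular the true policy itself has nonempty reachable sets from Liouville-almost every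
initial datum on the torus (`0 < ε < 1/2`). [folklore] -/
theorem Torus.ae_reach_truePolicy_nonempty {ε : ℝ} (hε : 0 < ε) (hε' : ε < 2⁻¹) (N : ℕ) :
    ∀ᵐ z ∂liouville (Torus.geometry d) N ε, ∀ t : ℝ,
      ((truePolicy (Torus.geometry d) ε : ControlPolicy d (UnitAddTorus d) N).Reach
        (Torus.geometry d) ε t z).Nonempty :=
  Torus.ae_reach_nonempty hε hε' N fun _ _ _ _ => Subset.rfl

end Flow

end Kinetic

end

end Literature.Analysis.FluidPDE
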